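import Summits.QuantumFields.YangMills.Theorems.UnitScaleTiltProp7CovCombMeanFrames
import Literature.MathematicalPhysics.QuantumFieldTheory.Balaban1983to89.B10StarCount
import HarnessLib

/-!
# Route `UnitScaleTilt`, crux K1 «MinimiserStabilityRegPr» (stmt-QuantumFields-19200), route-R [RP] at a curved background — THE CURVED N6,
# ROW (R-B), PART 6a (first half of FILE 3, the one-step gradient transfer): THE COUNTING — the block∕double-line average of a nonnegative site
# function has `ℓ²` norm at most `L^{(4−d)/2}` times that of the function, with constant EXACTLY one

Cell `ym3-torus`, D-0154 (3c) R3 twin-width seat `ym-routeR-w2` (W-SEAT MAP pass #3 row M9; architecture «ℓ²-Minkowski over levels, level-local», ★★OWNER g26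
ACK 12).  THEOREMS ONLY (0 `def`, 0 `sorry`); `--supports stmt-QuantumFields-19200`, count-neutral.  YM₃ on T³ is a ladder rung (R3), not the Clay problem; nothing here
claims the curved N6 bound, S2, P, the crux or the gap.

WHY.  The displayed row (hgrad) of ✓∕⧗ `Prop7CovIterLambdaEnergy.sum_normSq_covIterLambda_le` asks for `‖∇^{(j)}G_j‖²_{ℓ²} ≤ C_g·L^j·E`: the one-step transfer
`‖∇^{(j+1)}LINE_j(X)‖_{ℓ²} ≤ L^{(4−d)/2}‖∇^{(j)}X‖_{ℓ²} + (curvature defects)` iterated.  Pointwise (part 6b), the covariant difference of the comb-transported line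
means at two neighbouring coarse bonds telescopes (twice: along `e_ν` over `L` steps, then along the line) into `L^{−d}Σ_{r}Σ_{s<L}Σ_{t<L} ‖(∇^{(j)}_νX)(x_r + se_ν + te_μ)‖`
plus loop defects.  THIS file is the `ℓ²` COUNTING of that main term, where the k-uniformity of the whole (R-B) chain is decided: by Jensen over the `L^d·L·L` terms and the
two bijections «(block, offset) ↔ fine site» (`B5Leaf237C0Torus.sum_bsite`) and «translation of the torus» (`B10StarCount.shiftEquiv`), the constant is EXACTLY `L^{4−d}` —
no overlap factor, hence no compounding along the levels (`d = 3`: `√L` per level, the geometric law of `Prop7IterLambdaBound`).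

WHAT IS PROVED (ns `…Theorems.Prop7CovLineGradCount`).
* `sum_comp_shift_iterate` — `Σ_x F(x + te_μ) = Σ_x F(x)`; `sq_blockAvg_le` — Jensen on one block.
* ★★ `sum_sq_blockLineAvg_le` — `Σ_{y} (L^{−d}Σ_rΣ_{s<L}Σ_{t<L} g(x_r(y) + se_ν + te_μ))² ≤ L^{4}·L^{−d}·Σ_x g(x)²` for every nonnegative `g`.
HONEST SCOPE.  Counting only; the pointwise covariant estimate (part 6b) and the iteration are not here.

References: T. Bałaban, CMP 95 (1984) 17–40 [Balaban1984PropagatorsI] ((1.18)–(1.20) pp.19–20); CMP 99 (1985) 75–102 [Balaban1985RegularSpaces] ((1.1) p.76).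
-/

noncomputable section

open scoped BigOperators

namespace Summit.QuantumFields.YangMills.Theorems.Prop7CovLineGradCount

open Literature.MathematicalPhysics.QuantumFieldTheory.Balaban1983to89
open Finset B1RG242Torus
open B5Leaf237C0Torus (bsite sum_bsite)
open B10StarCount (shiftEquiv)
open Summit.QuantumFields.YangMills.Theorems.Prop7CovCombMeanFrames (sitesPerDir_eq predL_succ)

variable {P : Params} {j : ℕ}

/-- **TRANSLATION INVARIANCE OF TORUS SUMS**: `Σ_x F(x + te_μ) = Σ_x F(x)` (the shift is a bijection, `B10StarCount.shiftEquiv`). [folklore] -/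
theorem sum_comp_shift_iterate {M : Type*} [AddCommMonoid M] (F : Site P j → M) (μ : Fin P.d) :
    ∀ t : ℕ, ∑ x : Site P j, F ((fun z : Site P j => z.shift μ)^[t] x) = ∑ x : Site P j, F x
  | 0 => by simp
  | t + 1 => by
    have h := sum_comp_shift_iterate (fun x => F ((fun z : Site P j => z.shift μ) x)) μ t
    simp only [Function.iterate_succ_apply'] at h ⊢
    rw [show (∑ x : Site P j, F (((fun z : Site P j => z.shift μ)^[t] x).shift μ)) = ∑ x : Site P j, F ((fun z : Site P j => z.shift μ) ((fun z : Site P j => z.shift μ)^[t] x))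
      from rfl, h]
    exact (shiftEquiv (P := P) (i := j) μ).sum_comp (fun x => F x)

/-- **JENSEN ON ONE BLOCK∕DOUBLE LINE**: `(L^{−d}Σ_rΣ_{s<L}Σ_{t<L} a_{r,s,t})² ≤ L^{2}·L^{−d}·Σ_rΣ_sΣ_t a_{r,s,t}²` (`L^d·L·L` terms). [folklore] -/
theorem sq_blockAvg_le (a : (Fin P.d → Fin (P.L - 1 + 1)) → ℕ → ℕ → ℝ) :
    ((((P.L : ℝ)) ^ P.d)⁻¹ * ∑ r : Fin P.d → Fin (P.L - 1 + 1), ∑ s ∈ range P.L, ∑ t ∈ range P.L, a r s t) ^ 2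
      ≤ (P.L : ℝ) ^ 2 * (((P.L : ℝ)) ^ P.d)⁻¹ * ∑ r : Fin P.d → Fin (P.L - 1 + 1), ∑ s ∈ range P.L, ∑ t ∈ range P.L, a r s t ^ 2 := by
  have hL : (0 : ℝ) < P.L := by exact_mod_cast P.L_pos
  have hLd : (0 : ℝ) < (P.L : ℝ) ^ P.d := by positivity
  have hn1 : (((P.L - 1 : ℕ) : ℝ)) + 1 = (P.L : ℝ) := by exact_mod_cast Nat.sub_add_cancel P.L_pos
  -- flatten the triple sum to one `Finset.sum` over a product and apply Cauchy–Schwarz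
  have hcs : ∀ (s : Finset ((Fin P.d → Fin (P.L - 1 + 1)) × ℕ × ℕ)) (f : (Fin P.d → Fin (P.L - 1 + 1)) × ℕ × ℕ → ℝ),
      (∑ p ∈ s, f p) ^ 2 ≤ (s.card : ℝ) * ∑ p ∈ s, f p ^ 2 := fun s f => sq_sum_le_card_mul_sum_sq
  set S : Finset ((Fin P.d → Fin (P.L - 1 + 1)) × ℕ × ℕ) := univ ×ˢ (range P.L ×ˢ range P.L) with hS
  have hflat : ∀ f : (Fin P.d → Fin (P.L - 1 + 1)) → ℕ → ℕ → ℝ,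
      ∑ r : Fin P.d → Fin (P.L - 1 + 1), ∑ s ∈ range P.L, ∑ t ∈ range P.L, f r s t = ∑ p ∈ S, f p.1 p.2.1 p.2.2 := by
    intro f
    rw [hS, Finset.sum_product]
    exact Finset.sum_congr rfl fun r _ => by rw [Finset.sum_product]
  have hcard : (S.card : ℝ) = (P.L : ℝ) ^ P.d * ((P.L : ℝ) * P.L) := by
    rw [hS, Finset.card_product, Finset.card_product, Finset.card_univ, Fintype.card_fun, Fintype.card_fin, Fintype.card_fin, Finset.card_range]
    push_cast
    rw [hn1]
  rw [hflat a, hflat (fun r s t => a r s t ^ 2)]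
  have h := hcs S (fun p => a p.1 p.2.1 p.2.2)
  rw [hcard] at h
  rw [mul_pow]
  have hV0 : ((P.L : ℝ) ^ P.d) ≠ 0 := hLd.ne'
  calc (((P.L : ℝ) ^ P.d)⁻¹) ^ 2 * (∑ p ∈ S, a p.1 p.2.1 p.2.2) ^ 2
      ≤ (((P.L : ℝ) ^ P.d)⁻¹) ^ 2 * ((P.L : ℝ) ^ P.d * ((P.L : ℝ) * P.L) * ∑ p ∈ S, a p.1 p.2.1 p.2.2 ^ 2) :=
        mul_le_mul_of_nonneg_left h (sq_nonneg _)
    _ = (P.L : ℝ) ^ 2 * ((P.L : ℝ) ^ P.d)⁻¹ * ∑ p ∈ S, a p.1 p.2.1 p.2.2 ^ 2 := by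
        field_simp

/-- ★★ **THE COUNTING OF THE ONE-STEP GRADIENT TRANSFER, CONSTANT EXACTLY `L^{4−d}`**: for every nonnegative site function `g` on `T^{(j)}` and directions `μ, ν`,
`Σ_{y ∈ T^{(j+1)}} (L^{−d}Σ_rΣ_{s<L}Σ_{t<L} g(x_r(y) + se_ν + te_μ))² ≤ L²·L²·L^{−d}·Σ_{x ∈ T^{(j)}} g(x)²` — Jensen over the `L^{d+2}` terms, then for each `(s,t)` the map
`(y, r) ↦ x_r(y) + se_ν + te_μ` is a bijection onto `T^{(j)}` (block chart ∘ translation), so every fine site is counted exactly `L²` times.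
[cite: Balaban1984PropagatorsI, (1.18)-(1.20) pp.19-20] -/
theorem sum_sq_blockLineAvg_le (hj : j + 1 ≤ P.m + P.K) (g : Site P j → ℝ) (μ ν : Fin P.d) :
    ∑ y : Site P (j + 1), ((((P.L : ℝ)) ^ P.d)⁻¹ * ∑ r : Fin P.d → Fin (P.L - 1 + 1), ∑ s ∈ range P.L, ∑ t ∈ range P.L,
        g ((fun z : Site P j => z.shift ν)^[s] ((fun z : Site P j => z.shift μ)^[t] (bsite P j 1 predL_succ y r)))) ^ 2
      ≤ (P.L : ℝ) ^ 2 * (P.L : ℝ) ^ 2 * (((P.L : ℝ)) ^ P.d)⁻¹ * ∑ x : Site P j, g x ^ 2 := by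
  have h := sitesPerDir_eq hj
  -- Jensen per block
  have hJ := fun y : Site P (j + 1) => sq_blockAvg_le (P := P)
    (fun r s t => g ((fun z : Site P j => z.shift ν)^[s] ((fun z : Site P j => z.shift μ)^[t] (bsite P j 1 predL_succ y r))))
  refine (Finset.sum_le_sum fun y _ => hJ y).trans ?_
  rw [← Finset.mul_sum]
  -- exchange: blocks × offsets = fine sites, then translation invariance for each `(s, t)`
  have hex : ∑ y : Site P (j + 1), ∑ r : Fin P.d → Fin (P.L - 1 + 1), ∑ s ∈ range P.L, ∑ t ∈ range P.L,
        g ((fun z : Site P j => z.shift ν)^[s] ((fun z : Site P j => z.shift μ)^[t] (bsite P j 1 predL_succ y r))) ^ 2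
      = ∑ s ∈ range P.L, ∑ t ∈ range P.L, ∑ x : Site P j, g x ^ 2 := by
    calc _ = ∑ y : Site P (j + 1), ∑ r : Fin P.d → Fin (P.L - 1 + 1), ∑ p ∈ range P.L ×ˢ range P.L,
          g ((fun z : Site P j => z.shift ν)^[p.1] ((fun z : Site P j => z.shift μ)^[p.2] (bsite P j 1 predL_succ y r))) ^ 2 := by
            refine Finset.sum_congr rfl fun y _ => Finset.sum_congr rfl fun r _ => ?_
            rw [Finset.sum_product]
      _ = ∑ p ∈ range P.L ×ˢ range P.L, ∑ x : Site P j,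
          g ((fun z : Site P j => z.shift ν)^[p.1] ((fun z : Site P j => z.shift μ)^[p.2] x)) ^ 2 := by
            rw [← sum_bsite P h predL_succ (fun x => ∑ p ∈ range P.L ×ˢ range P.L,
              g ((fun z : Site P j => z.shift ν)^[p.1] ((fun z : Site P j => z.shift μ)^[p.2] x)) ^ 2)]
            exact Finset.sum_comm
      _ = ∑ p ∈ range P.L ×ˢ range P.L, ∑ x : Site P j, g x ^ 2 := by
            refine Finset.sum_congr rfl fun p _ => ?_
            rw [sum_comp_shift_iterate (fun x => g ((fun z : Site P j => z.shift ν)^[p.1] x) ^ 2) μ p.2,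
              sum_comp_shift_iterate (fun x => g x ^ 2) ν p.1]
      _ = _ := by rw [Finset.sum_product]
  rw [hex, Finset.sum_const, Finset.card_range, Finset.sum_const, Finset.card_range, nsmul_eq_mul, nsmul_eq_mul]
  ring_nf
  exact le_rfl

end Summit.QuantumFields.YangMills.Theorems.Prop7CovLineGradCount

end
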